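import Summits.NavierStokesRegularity.NavierStokesRegularity.Theses.SqueezeCycle
import Summits.NavierStokesRegularity.NavierStokesRegularity.Theorems.ExtremalBiaxialitySubcritical.Negative.LoadBearing
import Summits.NavierStokesRegularity.NavierStokesRegularity.Theorems.ExtremalBiaxialitySubcritical.Negative.ExactStrainFlows
import Summits.NavierStokesRegularity.NavierStokesRegularity.Theorems.ExtremalBiaxialitySubcritical.Negative.SelfSimilarStrain
import Summits.NavierStokesRegularity.NavierStokesRegularity.Theorems.SqueezeCycleExtremalBiaxialitySubcriticalReductions
import Summits.NavierStokesRegularity.NavierStokesRegularity.Theorems.SqueezeCycleExtremalBiaxialitySubcriticalExtremal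
import Summits.NavierStokesRegularity.NavierStokesRegularity.Theorems.SqueezeCycleStrainAlgebra
import Literature.Analysis.FluidPDE.LerayGaugeStrainSpectrum

/-! drefute Attack.lean — cheap certified facts about the 4 stubs of line quarter-bootstrap-pinning (skeleton 994055e8):
kill shapes (a stub kill is a crux / target kill), load-bearing mutations of `stub_largeExcessExclusion`, non-vacuity. -/

noncomputable section

open MeasureTheory Set Filter Topology
open scoped RealInnerProductSpace Matrix

namespace Summit.NavierStokesRegularity.NavierStokesRegularity.Cruxes.ExtremalBiaxialitySubcritical.DrefuteQBP

open Literature.Analysis.FluidPDE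
open Summit.NavierStokesRegularity.NavierStokesRegularity.Theses
open Summit.NavierStokesRegularity.NavierStokesRegularity.Theorems
open Summit.NavierStokesRegularity.NavierStokesRegularity.Theorems.ExtremalBiaxialitySubcritical.Negative

/-- Physical space. -/
local notation "ℝ³" => EuclideanSpace ℝ (Fin 3)

/-- VERBATIM ledger signature of `stub_gaugeStrainBound` (skeleton 994055e8). -/
def S_stub_gaugeStrainBound : Prop :=
  ∀ C : ℝ, ∃ K : ℝ, 0 < K ∧ ∀ (v' : ℝ → EuclideanSpace ℝ (Fin 3) → EuclideanSpace ℝ (Fin 3)), ContDiffOn ℝ (⊤ : ℕ∞) (Function.uncurry v') (Set.Iio 0 ×ˢ Set.univ) ∧ (∀ t < 0, Literature.Analysis.FluidPDE.VectorCalculus.IsDivFree (v' t)) ∧ (∀ s t : ℝ, s < t → t < 0 → ∀ x, v' t x = Literature.Analysis.FluidPDE.heatFlow (v' s) (t-s) x - ∫ τ in Set.Ioo s t, ∫ y, ((-(inner ℝ (x-y) (v' τ y) / (2*(t-τ)) * Literature.Analysis.UnboundedOperators.heatKernel (t-τ) (x-y))) • v' τ y + (∫ σ in Set.Ioi (t-τ),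 Literature.Analysis.UnboundedOperators.heatKernel σ (x-y) / (4*σ^2)) • (inner ℝ (x-y) (v' τ y) • v' τ y + inner ℝ (v' τ y) (v' τ y) • (x-y) + inner ℝ (x-y) (v' τ y) • v' τ y) - ((∫ σ in Set.Ioi (t-τ), Literature.Analysis.UnboundedOperators.heatKernel σ (x-y) / (8*σ^3)) * (inner ℝ (x-y) (v' τ y) * inner ℝ (x-y) (v' τ y))) • (x-y))) ∧ Literature.Analysis.FluidPDE.HasTypeITimeDecay C v' ∧ (∀ (x₀ : EuclideanSpace ℝ (Fin 3)) (t₀ r : ℝ), t₀ ≤ 0 → 0 < r → (∀ t, t₀ - r^2 < t → t < t₀ → r⁻¹ * ∫ x in Metric.ball x₀ r, ‖v' t x‖^2 ≤ C) ∧ r⁻¹ * ∫ t in Set.Ioo (t₀ - r^2) t₀, ∫ x in Metric.ball x₀ r, ‖fderiv ℝ (v' t) x‖^2 ≤ C) → ∀ t < 0, ∀ x, (∑ i, ∑ j, (((1 / 2 : ℝ) • (Literature.Analysis.FluidPDE.stdMatrix (fderiv ℝ (v' t) x : EuclideanSpace ℝ (Fin 3) →ₗ[ℝ] EuclideanSpace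 ℝ (Fin 3)) + (Literature.Analysis.FluidPDE.stdMatrix (fderiv ℝ (v' t) x : EuclideanSpace ℝ (Fin 3) →ₗ[ℝ] EuclideanSpace ℝ (Fin 3)))ᵀ)) i j) ^ 2) ≤ (K / (-t)) ^ 2

/-- VERBATIM ledger signature of `stub_cubicProductionBound` (skeleton 994055e8). -/
def S_stub_cubicProductionBound : Prop :=
  ∀ (A : Matrix (Fin 3) (Fin 3) ℝ) (m K : ℝ), A.trace = 0 → 0 ≤ m → 0 < K → 6 * m ^ 2 ≤ K ^ 2 → (Matrix.isHermitian_add_transpose_self A).eigenvalues₀ 1 ≤ 2 * m → (∑ i, ∑ j, (((1 / 2 : ℝ) • (A + Aᵀ)) i j) ^ 2) ≤ K ^ 2 → -4 * (((1 / 2 : ℝ) • (A + Aᵀ))).det ≤ (2 * m - 4 * m ^ 3 / K ^ 2) * (∑ i, ∑ j, (((1 / 2 : ℝ) • (A + Aᵀ)) i j) ^ 2)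

/-- VERBATIM ledger signature of `stub_leakyQuarterLawCeiling` (skeleton 994055e8). -/
def S_stub_leakyQuarterLawCeiling : Prop :=
  ∀ (C b : ℝ), b < 1 / 4 → ∀ (u : ℝ → EuclideanSpace ℝ (Fin 3) → EuclideanSpace ℝ (Fin 3)), ContDiffOn ℝ (⊤ : ℕ∞) (Function.uncurry u) (Set.Iio 0 ×ˢ Set.univ) ∧ (∀ t < 0, Literature.Analysis.FluidPDE.VectorCalculus.IsDivFree (u t)) ∧ (∀ s t : ℝ, s < t → t < 0 → ∀ x, u t x = Literature.Analysis.FluidPDE.heatFlow (u s) (t-s) x - ∫ τ in Set.Ioo s t, ∫ y, ((-(inner ℝ (x-y) (u τ y) / (2*(t-τ)) * Literature.Analysis.UnboundedOperators.heatKernel (t-τ) (x-y))) • u τ y + (∫ σ in Set.Ioi (t-τ), Literature.Analysis.UnboundedOperators.heatKernel σ (x-y) / (4*σ^2)) • (inner ℝ (x-y) (u τ y) • u τ y + inner ℝ (u τ y) (u τ y) • (x-y) + inner ℝ (x-y) (u τ y) • u τ y) - ((∫ σ in Set.Ioi (t-τ), Literature.Analysis.UnboundedOperators.heatKernel σ (x-y)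 / (8*σ^3)) * (inner ℝ (x-y) (u τ y) * inner ℝ (x-y) (u τ y))) • (x-y))) ∧ Literature.Analysis.FluidPDE.HasTypeITimeDecay C u ∧ (∀ (x₀ : EuclideanSpace ℝ (Fin 3)) (t₀ r : ℝ), t₀ ≤ 0 → 0 < r → (∀ t, t₀ - r^2 < t → t < t₀ → r⁻¹ * ∫ x in Metric.ball x₀ r, ‖u t x‖^2 ≤ C) ∧ r⁻¹ * ∫ t in Set.Ioo (t₀ - r^2) t₀, ∫ x in Metric.ball x₀ r, ‖fderiv ℝ (u t) x‖^2 ≤ C) → (∀ t < 0, ∀ x, -4 * (((1 / 2 : ℝ) • (Literature.Analysis.FluidPDE.stdMatrix (fderiv ℝ (u t) x : EuclideanSpace ℝ (Fin 3) →ₗ[ℝ] EuclideanSpace ℝ (Fin 3)) + (Literature.Analysis.FluidPDE.stdMatrix (fderiv ℝ (u t) x : EuclideanSpace ℝ (Fin 3) →ₗ[ℝ] EuclideanSpace ℝ (Fin 3)))ᵀ))).det ≤ (2 * b / (-t)) * (∑ i, ∑ j, (((1 / 2 : ℝ) • (Literature.Analysis.FluidPDE.stdMatrix (fderiv ℝ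 (u t) x : EuclideanSpace ℝ (Fin 3) →ₗ[ℝ] EuclideanSpace ℝ (Fin 3)) + (Literature.Analysis.FluidPDE.stdMatrix (fderiv ℝ (u t) x : EuclideanSpace ℝ (Fin 3) →ₗ[ℝ] EuclideanSpace ℝ (Fin 3)))ᵀ)) i j) ^ 2)) → ∀ t < 0, ∀ x, u t x = 0

/-- VERBATIM ledger signature of `stub_largeExcessExclusion` (skeleton 994055e8). -/
def S_stub_largeExcessExclusion : Prop :=
  ∀ (C K m : ℝ) (u : ℝ → EuclideanSpace ℝ (Fin 3) → EuclideanSpace ℝ (Fin 3)) (t₀ : ℝ) (x₀ : EuclideanSpace ℝ (Fin 3)), 0 < K → (∀ (v' : ℝ → EuclideanSpace ℝ (Fin 3) → EuclideanSpace ℝ (Fin 3)), ContDiffOn ℝ (⊤ : ℕ∞) (Function.uncurry v') (Set.Iio 0 ×ˢ Set.univ) ∧ (∀ t < 0, Literature.Analysis.FluidPDE.VectorCalculus.IsDivFree (v' t)) ∧ (∀ s t : ℝ, s < t → t < 0 → ∀ x, v' t x = Literature.Analysis.FluidPDE.heatFlow (v' s) (t-s) x - ∫ τ in Set.Ioo s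 t, ∫ y, ((-(inner ℝ (x-y) (v' τ y) / (2*(t-τ)) * Literature.Analysis.UnboundedOperators.heatKernel (t-τ) (x-y))) • v' τ y + (∫ σ in Set.Ioi (t-τ), Literature.Analysis.UnboundedOperators.heatKernel σ (x-y) / (4*σ^2)) • (inner ℝ (x-y) (v' τ y) • v' τ y + inner ℝ (v' τ y) (v' τ y) • (x-y) + inner ℝ (x-y) (v' τ y) • v' τ y) - ((∫ σ in Set.Ioi (t-τ), Literature.Analysis.UnboundedOperators.heatKernel σ (x-y) / (8*σ^3)) * (inner ℝ (x-y) (v' τ y) * inner ℝ (x-y) (v' τ y))) • (x-y))) ∧ Literature.Analysis.FluidPDE.HasTypeITimeDecay C v' ∧ (∀ (x₀ : EuclideanSpace ℝ (Fin 3)) (t₀ r : ℝ), t₀ ≤ 0 → 0 < r → (∀ t, t₀ - r^2 < t → t < t₀ → r⁻¹ * ∫ x in Metric.ball x₀ r, ‖v' t x‖^2 ≤ C) ∧ r⁻¹ * ∫ t in Set.Ioo (t₀ - r^2) t₀, ∫ x in Metric.ball x₀ r, ‖fderiv ℝ (v' t) x‖^2 ≤ C) → ∀ t < 0, ∀ x,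 (∑ i, ∑ j, (((1 / 2 : ℝ) • (Literature.Analysis.FluidPDE.stdMatrix (fderiv ℝ (v' t) x : EuclideanSpace ℝ (Fin 3) →ₗ[ℝ] EuclideanSpace ℝ (Fin 3)) + (Literature.Analysis.FluidPDE.stdMatrix (fderiv ℝ (v' t) x : EuclideanSpace ℝ (Fin 3) →ₗ[ℝ] EuclideanSpace ℝ (Fin 3)))ᵀ)) i j) ^ 2) ≤ (K / (-t)) ^ 2 ∧ Literature.Analysis.FluidPDE.lerayMiddleStrain v' t x ≤ m) → 0 ≤ m → 1 / 4 ≤ m - 2 * m ^ 3 / K ^ 2 → t₀ < 0 → (ContDiffOn ℝ (⊤ : ℕ∞) (Function.uncurry u) (Set.Iio 0 ×ˢ Set.univ) ∧ (∀ t < 0, Literature.Analysis.FluidPDE.VectorCalculus.IsDivFree (u t)) ∧ (∀ s t : ℝ, s < t → t < 0 → ∀ x, u t x = Literature.Analysis.FluidPDE.heatFlow (u s) (t-s) x - ∫ τ in Set.Ioo s t, ∫ y, ((-(inner ℝ (x-y) (u τ y) / (2*(t-τ)) * Literature.Analysis.UnboundedOperators.heatKernel (t-τ) (x-y))) • u τ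 y + (∫ σ in Set.Ioi (t-τ), Literature.Analysis.UnboundedOperators.heatKernel σ (x-y) / (4*σ^2)) • (inner ℝ (x-y) (u τ y) • u τ y + inner ℝ (u τ y) (u τ y) • (x-y) + inner ℝ (x-y) (u τ y) • u τ y) - ((∫ σ in Set.Ioi (t-τ), Literature.Analysis.UnboundedOperators.heatKernel σ (x-y) / (8*σ^3)) * (inner ℝ (x-y) (u τ y) * inner ℝ (x-y) (u τ y))) • (x-y))) ∧ Literature.Analysis.FluidPDE.HasTypeITimeDecay C u ∧ (∀ (x₀ : EuclideanSpace ℝ (Fin 3)) (t₀ r : ℝ), t₀ ≤ 0 → 0 < r → (∀ t, t₀ - r^2 < t → t < t₀ → r⁻¹ * ∫ x in Metric.ball x₀ r, ‖u t x‖^2 ≤ C) ∧ r⁻¹ * ∫ t in Set.Ioo (t₀ - r^2) t₀, ∫ x in Metric.ball x₀ r, ‖fderiv ℝ (u t) x‖^2 ≤ C)) → m ≤ Literature.Analysis.FluidPDE.lerayMiddleStrain u t₀ x₀ → False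

/-- `stub_largeExcessExclusion` with the ATTAINMENT clause `m ≤ Λ_u(t₀,x₀)` dropped. -/
def LE_WithoutAttainment : Prop :=
  ∀ (C K m : ℝ) (u : ℝ → EuclideanSpace ℝ (Fin 3) → EuclideanSpace ℝ (Fin 3)) (t₀ : ℝ) (x₀ : EuclideanSpace ℝ (Fin 3)), 0 < K → (∀ (v' : ℝ → EuclideanSpace ℝ (Fin 3) → EuclideanSpace ℝ (Fin 3)), ContDiffOn ℝ (⊤ : ℕ∞) (Function.uncurry v') (Set.Iio 0 ×ˢ Set.univ) ∧ (∀ t < 0, Literature.Analysis.FluidPDE.VectorCalculus.IsDivFree (v' t)) ∧ (∀ s t : ℝ, s < t → t < 0 → ∀ x, v' t x = Literature.Analysis.FluidPDE.heatFlow (v' s) (t-s) x - ∫ τ in Set.Ioo s t, ∫ y, ((-(inner ℝ (x-y) (v' τ y) / (2*(t-τ)) * Literature.Analysis.UnboundedOperators.heatKernel (t-τ) (x-y))) • v' τ y + (∫ σ in Set.Ioi (t-τ), Literature.Analysis.UnboundedOperators.heatKernel σ (x-y) / (4*σ^2)) • (inner ℝ (x-y) (v' τ y) • v' τ y + inner ℝ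 (v' τ y) (v' τ y) • (x-y) + inner ℝ (x-y) (v' τ y) • v' τ y) - ((∫ σ in Set.Ioi (t-τ), Literature.Analysis.UnboundedOperators.heatKernel σ (x-y) / (8*σ^3)) * (inner ℝ (x-y) (v' τ y) * inner ℝ (x-y) (v' τ y))) • (x-y))) ∧ Literature.Analysis.FluidPDE.HasTypeITimeDecay C v' ∧ (∀ (x₀ : EuclideanSpace ℝ (Fin 3)) (t₀ r : ℝ), t₀ ≤ 0 → 0 < r → (∀ t, t₀ - r^2 < t → t < t₀ → r⁻¹ * ∫ x in Metric.ball x₀ r, ‖v' t x‖^2 ≤ C) ∧ r⁻¹ * ∫ t in Set.Ioo (t₀ - r^2) t₀, ∫ x in Metric.ball x₀ r, ‖fderiv ℝ (v' t) x‖^2 ≤ C) → ∀ t < 0, ∀ x, (∑ i, ∑ j, (((1 / 2 : ℝ) • (Literature.Analysis.FluidPDE.stdMatrix (fderiv ℝ (v' t) x : EuclideanSpace ℝ (Fin 3) →ₗ[ℝ] EuclideanSpace ℝ (Fin 3)) + (Literature.Analysis.FluidPDE.stdMatrix (fderiv ℝ (v' t) x : EuclideanSpace ℝ (Fin 3) →ₗ[ℝ]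 EuclideanSpace ℝ (Fin 3)))ᵀ)) i j) ^ 2) ≤ (K / (-t)) ^ 2 ∧ Literature.Analysis.FluidPDE.lerayMiddleStrain v' t x ≤ m) → 0 ≤ m → 1 / 4 ≤ m - 2 * m ^ 3 / K ^ 2 → t₀ < 0 → (ContDiffOn ℝ (⊤ : ℕ∞) (Function.uncurry u) (Set.Iio 0 ×ˢ Set.univ) ∧ (∀ t < 0, Literature.Analysis.FluidPDE.VectorCalculus.IsDivFree (u t)) ∧ (∀ s t : ℝ, s < t → t < 0 → ∀ x, u t x = Literature.Analysis.FluidPDE.heatFlow (u s) (t-s) x - ∫ τ in Set.Ioo s t, ∫ y, ((-(inner ℝ (x-y) (u τ y) / (2*(t-τ)) * Literature.Analysis.UnboundedOperators.heatKernel (t-τ) (x-y))) • u τ y + (∫ σ in Set.Ioi (t-τ), Literature.Analysis.UnboundedOperators.heatKernel σ (x-y) / (4*σ^2)) • (inner ℝ (x-y) (u τ y) • u τ y + inner ℝ (u τ y) (u τ y) • (x-y) + inner ℝ (x-y) (u τ y) • u τ y) - ((∫ σ in Set.Ioi (t-τ), Literature.Analysis.UnboundedOperators.heatKernel σ (x-y)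 / (8*σ^3)) * (inner ℝ (x-y) (u τ y) * inner ℝ (x-y) (u τ y))) • (x-y))) ∧ Literature.Analysis.FluidPDE.HasTypeITimeDecay C u ∧ (∀ (x₀ : EuclideanSpace ℝ (Fin 3)) (t₀ r : ℝ), t₀ ≤ 0 → 0 < r → (∀ t, t₀ - r^2 < t → t < t₀ → r⁻¹ * ∫ x in Metric.ball x₀ r, ‖u t x‖^2 ≤ C) ∧ r⁻¹ * ∫ t in Set.Ioo (t₀ - r^2) t₀, ∫ x in Metric.ball x₀ r, ‖fderiv ℝ (u t) x‖^2 ≤ C)) → False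

/-- `stub_largeExcessExclusion` with the MEMBERSHIP clause `u ∈ 𝒦_C` dropped. -/
def LE_WithoutMembership : Prop :=
  ∀ (C K m : ℝ) (u : ℝ → EuclideanSpace ℝ (Fin 3) → EuclideanSpace ℝ (Fin 3)) (t₀ : ℝ) (x₀ : EuclideanSpace ℝ (Fin 3)), 0 < K → (∀ (v' : ℝ → EuclideanSpace ℝ (Fin 3) → EuclideanSpace ℝ (Fin 3)), ContDiffOn ℝ (⊤ : ℕ∞) (Function.uncurry v') (Set.Iio 0 ×ˢ Set.univ) ∧ (∀ t < 0, Literature.Analysis.FluidPDE.VectorCalculus.IsDivFree (v' t)) ∧ (∀ s t : ℝ, s < t → t < 0 → ∀ x, v' t x = Literature.Analysis.FluidPDE.heatFlow (v' s) (t-s) x - ∫ τ in Set.Ioo s t, ∫ y, ((-(inner ℝ (x-y) (v' τ y) / (2*(t-τ)) * Literature.Analysis.UnboundedOperators.heatKernel (t-τ) (x-y))) • v' τ y + (∫ σ in Set.Ioi (t-τ), Literature.Analysis.UnboundedOperators.heatKernel σ (x-y) / (4*σ^2)) • (inner ℝ (x-y) (v' τ y) • v' τ y + inner ℝ (v' τ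 y) (v' τ y) • (x-y) + inner ℝ (x-y) (v' τ y) • v' τ y) - ((∫ σ in Set.Ioi (t-τ), Literature.Analysis.UnboundedOperators.heatKernel σ (x-y) / (8*σ^3)) * (inner ℝ (x-y) (v' τ y) * inner ℝ (x-y) (v' τ y))) • (x-y))) ∧ Literature.Analysis.FluidPDE.HasTypeITimeDecay C v' ∧ (∀ (x₀ : EuclideanSpace ℝ (Fin 3)) (t₀ r : ℝ), t₀ ≤ 0 → 0 < r → (∀ t, t₀ - r^2 < t → t < t₀ → r⁻¹ * ∫ x in Metric.ball x₀ r, ‖v' t x‖^2 ≤ C) ∧ r⁻¹ * ∫ t in Set.Ioo (t₀ - r^2) t₀, ∫ x in Metric.ball x₀ r, ‖fderiv ℝ (v' t) x‖^2 ≤ C) → ∀ t < 0, ∀ x, (∑ i, ∑ j, (((1 / 2 : ℝ) • (Literature.Analysis.FluidPDE.stdMatrix (fderiv ℝ (v' t) x : EuclideanSpace ℝ (Fin 3) →ₗ[ℝ] EuclideanSpace ℝ (Fin 3)) + (Literature.Analysis.FluidPDE.stdMatrix (fderiv ℝ (v' t) x : EuclideanSpace ℝ (Fin 3) →ₗ[ℝ]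 EuclideanSpace ℝ (Fin 3)))ᵀ)) i j) ^ 2) ≤ (K / (-t)) ^ 2 ∧ Literature.Analysis.FluidPDE.lerayMiddleStrain v' t x ≤ m) → 0 ≤ m → 1 / 4 ≤ m - 2 * m ^ 3 / K ^ 2 → t₀ < 0 → m ≤ Literature.Analysis.FluidPDE.lerayMiddleStrain u t₀ x₀ → False

/-- `stub_largeExcessExclusion` with the GUARD `t₀ < 0` dropped. -/
def LE_WithoutTime : Prop :=
  ∀ (C K m : ℝ) (u : ℝ → EuclideanSpace ℝ (Fin 3) → EuclideanSpace ℝ (Fin 3)) (t₀ : ℝ) (x₀ : EuclideanSpace ℝ (Fin 3)), 0 < K → (∀ (v' : ℝ → EuclideanSpace ℝ (Fin 3) → EuclideanSpace ℝ (Fin 3)), ContDiffOn ℝ (⊤ : ℕ∞) (Function.uncurry v') (Set.Iio 0 ×ˢ Set.univ) ∧ (∀ t < 0, Literature.Analysis.FluidPDE.VectorCalculus.IsDivFree (v' t)) ∧ (∀ s t : ℝ, s < t → t < 0 → ∀ x, v' t x = Literature.Analysis.FluidPDE.heatFlow (v' s) (t-s) x - ∫ τ in Set.Ioo s t, ∫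 y, ((-(inner ℝ (x-y) (v' τ y) / (2*(t-τ)) * Literature.Analysis.UnboundedOperators.heatKernel (t-τ) (x-y))) • v' τ y + (∫ σ in Set.Ioi (t-τ), Literature.Analysis.UnboundedOperators.heatKernel σ (x-y) / (4*σ^2)) • (inner ℝ (x-y) (v' τ y) • v' τ y + inner ℝ (v' τ y) (v' τ y) • (x-y) + inner ℝ (x-y) (v' τ y) • v' τ y) - ((∫ σ in Set.Ioi (t-τ), Literature.Analysis.UnboundedOperators.heatKernel σ (x-y) / (8*σ^3)) * (inner ℝ (x-y) (v' τ y) * inner ℝ (x-y) (v' τ y))) • (x-y))) ∧ Literature.Analysis.FluidPDE.HasTypeITimeDecay C v' ∧ (∀ (x₀ : EuclideanSpace ℝ (Fin 3)) (t₀ r : ℝ), t₀ ≤ 0 → 0 < r → (∀ t, t₀ - r^2 < t → t < t₀ → r⁻¹ * ∫ x in Metric.ball x₀ r, ‖v' t x‖^2 ≤ C) ∧ r⁻¹ * ∫ t in Set.Ioo (t₀ - r^2) t₀, ∫ x in Metric.ball x₀ r, ‖fderiv ℝ (v' t) x‖^2 ≤ C) → ∀ t < 0, ∀ x, (∑ i,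 ∑ j, (((1 / 2 : ℝ) • (Literature.Analysis.FluidPDE.stdMatrix (fderiv ℝ (v' t) x : EuclideanSpace ℝ (Fin 3) →ₗ[ℝ] EuclideanSpace ℝ (Fin 3)) + (Literature.Analysis.FluidPDE.stdMatrix (fderiv ℝ (v' t) x : EuclideanSpace ℝ (Fin 3) →ₗ[ℝ] EuclideanSpace ℝ (Fin 3)))ᵀ)) i j) ^ 2) ≤ (K / (-t)) ^ 2 ∧ Literature.Analysis.FluidPDE.lerayMiddleStrain v' t x ≤ m) → 0 ≤ m → 1 / 4 ≤ m - 2 * m ^ 3 / K ^ 2 → (ContDiffOn ℝ (⊤ : ℕ∞) (Function.uncurry u) (Set.Iio 0 ×ˢ Set.univ) ∧ (∀ t < 0, Literature.Analysis.FluidPDE.VectorCalculus.IsDivFree (u t)) ∧ (∀ s t : ℝ, s < t → t < 0 → ∀ x, u t x = Literature.Analysis.FluidPDE.heatFlow (u s) (t-s) x - ∫ τ in Set.Ioo s t, ∫ y, ((-(inner ℝ (x-y) (u τ y) / (2*(t-τ)) * Literature.Analysis.UnboundedOperators.heatKernel (t-τ) (x-y))) • u τ y + (∫ σ in Set.Ioi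 (t-τ), Literature.Analysis.UnboundedOperators.heatKernel σ (x-y) / (4*σ^2)) • (inner ℝ (x-y) (u τ y) • u τ y + inner ℝ (u τ y) (u τ y) • (x-y) + inner ℝ (x-y) (u τ y) • u τ y) - ((∫ σ in Set.Ioi (t-τ), Literature.Analysis.UnboundedOperators.heatKernel σ (x-y) / (8*σ^3)) * (inner ℝ (x-y) (u τ y) * inner ℝ (x-y) (u τ y))) • (x-y))) ∧ Literature.Analysis.FluidPDE.HasTypeITimeDecay C u ∧ (∀ (x₀ : EuclideanSpace ℝ (Fin 3)) (t₀ r : ℝ), t₀ ≤ 0 → 0 < r → (∀ t, t₀ - r^2 < t → t < t₀ → r⁻¹ * ∫ x in Metric.ball x₀ r, ‖u t x‖^2 ≤ C) ∧ r⁻¹ * ∫ t in Set.Ioo (t₀ - r^2) t₀, ∫ x in Metric.ball x₀ r, ‖fderiv ℝ (u t) x‖^2 ≤ C)) → m ≤ Literature.Analysis.FluidPDE.lerayMiddleStrain u t₀ x₀ → False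

/-- `stub_largeExcessExclusion` with the CLASS-WIDE clause (strain bound ∧ ceiling on 𝒦_C) dropped. -/
def LE_WithoutClasswide : Prop :=
  ∀ (C K m : ℝ) (u : ℝ → EuclideanSpace ℝ (Fin 3) → EuclideanSpace ℝ (Fin 3)) (t₀ : ℝ) (x₀ : EuclideanSpace ℝ (Fin 3)), 0 < K → 0 ≤ m → 1 / 4 ≤ m - 2 * m ^ 3 / K ^ 2 → t₀ < 0 → (ContDiffOn ℝ (⊤ : ℕ∞) (Function.uncurry u) (Set.Iio 0 ×ˢ Set.univ) ∧ (∀ t < 0, Literature.Analysis.FluidPDE.VectorCalculus.IsDivFree (u t)) ∧ (∀ s t : ℝ, s < t → t < 0 → ∀ x, u t x = Literature.Analysis.FluidPDE.heatFlow (u s) (t-s) x - ∫ τ in Set.Ioo s t, ∫ y, ((-(inner ℝ (x-y) (u τ y) / (2*(t-τ)) * Literature.Analysis.UnboundedOperators.heatKernel (t-τ) (x-y))) • u τ y + (∫ σ in Set.Ioi (t-τ), Literature.Analysis.UnboundedOperators.heatKernel σ (x-y) / (4*σ^2)) • (inner ℝ (x-y) (u τ y) • u τ y + inner ℝ (u τ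 y) (u τ y) • (x-y) + inner ℝ (x-y) (u τ y) • u τ y) - ((∫ σ in Set.Ioi (t-τ), Literature.Analysis.UnboundedOperators.heatKernel σ (x-y) / (8*σ^3)) * (inner ℝ (x-y) (u τ y) * inner ℝ (x-y) (u τ y))) • (x-y))) ∧ Literature.Analysis.FluidPDE.HasTypeITimeDecay C u ∧ (∀ (x₀ : EuclideanSpace ℝ (Fin 3)) (t₀ r : ℝ), t₀ ≤ 0 → 0 < r → (∀ t, t₀ - r^2 < t → t < t₀ → r⁻¹ * ∫ x in Metric.ball x₀ r, ‖u t x‖^2 ≤ C) ∧ r⁻¹ * ∫ t in Set.Ioo (t₀ - r^2) t₀, ∫ x in Metric.ball x₀ r, ‖fderiv ℝ (u t) x‖^2 ≤ C)) → m ≤ Literature.Analysis.FluidPDE.lerayMiddleStrain u t₀ x₀ → False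

/-! ## Kill shapes: a counterexample to either open stub is a counterexample to the crux / the route target -/

/-- **crux ⇒ `stub_largeExcessExclusion`**: the stub is the crux restricted to the regime
`1/4 ≤ m − 2m³/K²` (so any kill of the stub kills the crux; no cheaper kill shape exists). -/
theorem largeExcess_of_crux (hX : SqueezeCycle.ExtremalBiaxialitySubcritical) :
    S_stub_largeExcessExclusion := by
  intro C K m u t₀ x₀ hK hcls hm0 hreg ht₀ hu hatt
  have h8 : m < 1 / 8 := hX C m u t₀ x₀ ht₀ hu ((le_lerayMiddleStrain_iff ht₀ m).1 hatt)
    (fun v' hv' t ht x => (lerayMiddleStrain_le_iff ht m).1 (hcls v' hv' t ht x).2)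
  have h3 : 0 ≤ 2 * m ^ 3 / K ^ 2 := by positivity
  linarith

/-- **target ⇒ `stub_leakyQuarterLawCeiling`**: under `SqueezeLiouville` every element vanishes, so
any kill of the leaky quarter law (a NONZERO element of some `𝒦_C` with a production ceiling) kills
the route target itself. -/
theorem leaky_of_squeezeLiouville (hL : SqueezeCycle.SqueezeLiouville) :
    S_stub_leakyQuarterLawCeiling :=
  fun C _ _ u hu _ => hL C u hu

/-- Contrapositive bookkeeping: `¬ leaky ⇒ ¬ target`. -/
theorem not_squeezeLiouville_of_not_leaky (h : ¬ S_stub_leakyQuarterLawCeiling) :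
    ¬ SqueezeCycle.SqueezeLiouville :=
  fun hL => h (leaky_of_squeezeLiouville hL)

/-- Contrapositive bookkeeping: `¬ largeExcess ⇒ ¬ crux`. -/
theorem not_crux_of_not_largeExcess (h : ¬ S_stub_largeExcessExclusion) :
    ¬ SqueezeCycle.ExtremalBiaxialitySubcritical :=
  fun hX => h (largeExcess_of_crux hX)

/-! ## The class-wide clause over `𝒦_0 = {0}` -/

/-- Over `𝒦_0` (all slices vanish) the class-wide clause of `stub_largeExcessExclusion` holds for
every `K` and every `m ≥ 0`. -/
theorem classwide_zero (K : ℝ) {m : ℝ} (hm : 0 ≤ m) :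
    (∀ (v' : ℝ → EuclideanSpace ℝ (Fin 3) → EuclideanSpace ℝ (Fin 3)), ContDiffOn ℝ (⊤ : ℕ∞) (Function.uncurry v') (Set.Iio 0 ×ˢ Set.univ) ∧ (∀ t < 0, Literature.Analysis.FluidPDE.VectorCalculus.IsDivFree (v' t)) ∧ (∀ s t : ℝ, s < t → t < 0 → ∀ x, v' t x = Literature.Analysis.FluidPDE.heatFlow (v' s) (t-s) x - ∫ τ in Set.Ioo s t, ∫ y, ((-(inner ℝ (x-y) (v' τ y) / (2*(t-τ)) * Literature.Analysis.UnboundedOperators.heatKernel (t-τ) (x-y))) • v' τ y + (∫ σ in Set.Ioi (t-τ), Literature.Analysis.UnboundedOperators.heatKernel σ (x-y) / (4*σ^2)) • (inner ℝ (x-y) (v' τ y) • v' τ y + inner ℝ (v' τ y) (v' τ y) • (x-y) + inner ℝ (x-y) (v' τ y) • v' τ y) - ((∫ σ in Set.Ioi (t-τ), Literature.Analysis.UnboundedOperators.heatKernel σ (x-y) / (8*σ^3)) * (inner ℝ (x-y) (v' τ y) * inner ℝ (x-y) (v' τ y))) • (x-y))) ∧ Literature.Analysis.FluidPDE.HasTypeITimeDecay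 0 v' ∧ (∀ (x₀ : EuclideanSpace ℝ (Fin 3)) (t₀ r : ℝ), t₀ ≤ 0 → 0 < r → (∀ t, t₀ - r^2 < t → t < t₀ → r⁻¹ * ∫ x in Metric.ball x₀ r, ‖v' t x‖^2 ≤ 0) ∧ r⁻¹ * ∫ t in Set.Ioo (t₀ - r^2) t₀, ∫ x in Metric.ball x₀ r, ‖fderiv ℝ (v' t) x‖^2 ≤ 0) → ∀ t < 0, ∀ x, (∑ i, ∑ j, (((1 / 2 : ℝ) • (Literature.Analysis.FluidPDE.stdMatrix (fderiv ℝ (v' t) x : EuclideanSpace ℝ (Fin 3) →ₗ[ℝ] EuclideanSpace ℝ (Fin 3)) + (Literature.Analysis.FluidPDE.stdMatrix (fderiv ℝ (v' t) x : EuclideanSpace ℝ (Fin 3) →ₗ[ℝ] EuclideanSpace ℝ (Fin 3)))ᵀ)) i j) ^ 2) ≤ (K / (-t)) ^ 2 ∧ Literature.Analysis.FluidPDE.lerayMiddleStrain v' t x ≤ m) := by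
  intro v' hv' t ht x
  have h0 : v' t = fun _ => (0 : ℝ³) := funext fun y => squeezeClass_zero_slice_zero hv' ht y
  have hfd : fderiv ℝ (v' t) x = 0 := by rw [h0]; simp
  refine ⟨?_, (lerayMiddleStrain_le_iff ht m).2 (isClassMax_zero hm v' hv' t ht x)⟩
  have hz : ∀ i j, ((1 / 2 : ℝ) • (Literature.Analysis.FluidPDE.stdMatrix (fderiv ℝ (v' t) x : EuclideanSpace ℝ (Fin 3) →ₗ[ℝ] EuclideanSpace ℝ (Fin 3)) + (Literature.Analysis.FluidPDE.stdMatrix (fderiv ℝ (v' t) x : EuclideanSpace ℝ (Fin 3) →ₗ[ℝ] EuclideanSpace ℝ (Fin 3)))ᵀ)) i j = 0 := by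
    intro i j
    simp [hfd]
  simp only [hz]
  simp only [ne_eq, OfNat.ofNat_ne_zero, not_false_eq_true, zero_pow, Finset.sum_const_zero]
  positivity

/-! ## Load-bearing clauses of `stub_largeExcessExclusion` -/

/-- **Attainment is load-bearing**: drop `m ≤ Λ_u(t₀,x₀)` and the stub fails at `C = 0`, `K = 10`,
`m = 1`, `u ≡ 0 ∈ 𝒦_0`, `t₀ = −1` (`1/4 ≤ 1 − 2/100`). -/
theorem le_false_without_attainment : ¬ LE_WithoutAttainment := by
  intro h
  exact h 0 10 1 0 (-1) 0 (by norm_num) (classwide_zero 10 zero_le_one) zero_le_one (by norm_num)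
    (by norm_num) (squeezeClass_zero le_rfl)

/-- **Membership is load-bearing**: drop `u ∈ 𝒦_C` and the stub fails at `C = 0`, `K = 10`, `m = 1`,
`t₀ = −1`, `x₀ = 0`, with `u` the exact Navier–Stokes flow `pulsedStrain 1` (Λ = 1 at `t = −1`). -/
theorem le_false_without_membership : ¬ LE_WithoutMembership := by
  intro h
  have hatt : (1 : ℝ) ≤ lerayMiddleStrain (pulsedStrain 1) (-1) 0 :=
    (le_lerayMiddleStrain_iff (by norm_num) 1).2 (by simpa using pulsedStrain_attains 1 0)
  exact h 0 10 1 (pulsedStrain 1) (-1) 0 (by norm_num) (classwide_zero 10 zero_le_one) zero_le_one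
    (by norm_num) (by norm_num) hatt

/-- The junk slice: `0` on `t < 0`, `−x` on `t ≥ 0` (an element of `𝒦_0`, `junkSlice_mem`). -/
def junkSlice : ℝ → ℝ³ → ℝ³ := fun t x => if t < 0 then 0 else -x

/-- At the junk time `t₀ = 1` the gauge weight `−t₀ = −1` turns the contraction `−x` into
`Λ = 1`. -/
theorem one_le_lerayMiddleStrain_junkSlice : (1 : ℝ) ≤ lerayMiddleStrain junkSlice 1 0 := by
  rw [lerayMiddleStrain_def]
  have hs : junkSlice 1 = fun x : ℝ³ => -x := by
    funext x; simp [junkSlice]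
  have hd : fderiv ℝ (fun x : ℝ³ => -x) 0 = -ContinuousLinearMap.id ℝ ℝ³ := by
    rw [fderiv_fun_neg, fderiv_fun_id]
  rw [hs, hd]
  have hle : strainEigenvalues ((-ContinuousLinearMap.id ℝ ℝ³ : ℝ³ →L[ℝ] ℝ³) : ℝ³ →ₗ[ℝ] ℝ³)
      finrank_euclideanSpace_fin 1 ≤ -1 := by
    rw [strainEigenvalues_mid_le_iff]
    refine ⟨EuclideanSpace.single 0 1, EuclideanSpace.single 1 1, by simp, by simp,
      by simp [EuclideanSpace.inner_single_left], fun α β => ?_⟩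
    have e : inner ℝ (α • (EuclideanSpace.single 0 (1:ℝ) : ℝ³) + β • EuclideanSpace.single 1 (1:ℝ))
        (α • (EuclideanSpace.single 0 (1:ℝ) : ℝ³) + β • EuclideanSpace.single 1 (1:ℝ)) = α ^ 2 + β ^ 2 := by
      rw [real_inner_self_eq_norm_sq, norm_sq_smul_add_smul (by simp) (by simp)
        (by simp [EuclideanSpace.inner_single_left])]
    have hneg : ∀ ξ : ℝ³, ((-ContinuousLinearMap.id ℝ ℝ³ : ℝ³ →L[ℝ] ℝ³) : ℝ³ →ₗ[ℝ] ℝ³) ξ = -ξ :=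
      fun ξ => rfl
    rw [hneg, inner_neg_left, e]
    linarith
  linarith

/-- **The guard `t₀ < 0` is load-bearing**: drop it and the stub fails at the junk time `t₀ = 1`
(`C = 0`, `K = 10`, `m = 1`, `u = junkSlice ∈ 𝒦_0`). -/
theorem le_false_without_time : ¬ LE_WithoutTime := by
  intro h
  exact h 0 10 1 junkSlice 1 0 (by norm_num) (classwide_zero 10 zero_le_one) zero_le_one (by norm_num)
    junkSlice_mem one_le_lerayMiddleStrain_junkSlice

/-- **The class-wide clause is Liouville-hard to drop**: without it the stub says "no element of any
`𝒦_C` has `Λ ≥ m` anywhere once `1/4 ≤ m − 2m³/K²`", which FOLLOWS from the route target (so no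
cheap witness can exist short of a nontrivial Type-I ancient element). -/
theorem le_withoutClasswide_of_squeezeLiouville (hL : SqueezeCycle.SqueezeLiouville) :
    LE_WithoutClasswide := by
  intro C K m u t₀ x₀ hK hm0 hreg ht₀ hu hatt
  have hz : ∀ x, u t₀ x = 0 := fun x => hL C u hu t₀ ht₀ x
  have hm : m ≤ 0 :=
    nonpos_of_twoFrame_lower_of_slice_zero hz ((le_lerayMiddleStrain_iff ht₀ m).1 hatt)
  have h3 : 0 ≤ 2 * m ^ 3 / K ^ 2 := by positivity
  linarith

/-! ## Non-vacuity of `stub_leakyQuarterLawCeiling` -/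

/-- The hypotheses of the leaky quarter law are jointly satisfiable (`C = 0`, `b = 0`, `u ≡ 0`):
the stub is not vacuous; its content is at NONZERO elements (none known: Type-I Liouville). -/
theorem leaky_hypotheses_satisfiable :
    ∃ (C b : ℝ) (u : ℝ → ℝ³ → ℝ³), b < 1 / 4 ∧ (ContDiffOn ℝ (⊤ : ℕ∞) (Function.uncurry u) (Set.Iio 0 ×ˢ Set.univ) ∧ (∀ t < 0, Literature.Analysis.FluidPDE.VectorCalculus.IsDivFree (u t)) ∧ (∀ s t : ℝ, s < t → t < 0 → ∀ x, u t x = Literature.Analysis.FluidPDE.heatFlow (u s) (t-s) x - ∫ τ in Set.Ioo s t, ∫ y, ((-(inner ℝ (x-y) (u τ y) / (2*(t-τ)) * Literature.Analysis.UnboundedOperators.heatKernel (t-τ) (x-y))) • u τ y + (∫ σ in Set.Ioi (t-τ), Literature.Analysis.UnboundedOperators.heatKernel σ (x-y) / (4*σ^2)) • (inner ℝ (x-y) (u τ y) • u τ y + inner ℝ (u τ y) (u τ y) • (x-y) + inner ℝ (x-y) (u τ y) • u τ y) - ((∫ σ in Set.Ioi (t-τ), Literature.Analysis.UnboundedOperators.heatKernel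 σ (x-y) / (8*σ^3)) * (inner ℝ (x-y) (u τ y) * inner ℝ (x-y) (u τ y))) • (x-y))) ∧ Literature.Analysis.FluidPDE.HasTypeITimeDecay C u ∧ (∀ (x₀ : EuclideanSpace ℝ (Fin 3)) (t₀ r : ℝ), t₀ ≤ 0 → 0 < r → (∀ t, t₀ - r^2 < t → t < t₀ → r⁻¹ * ∫ x in Metric.ball x₀ r, ‖u t x‖^2 ≤ C) ∧ r⁻¹ * ∫ t in Set.Ioo (t₀ - r^2) t₀, ∫ x in Metric.ball x₀ r, ‖fderiv ℝ (u t) x‖^2 ≤ C)) ∧ (∀ t < 0, ∀ x, -4 * (((1 / 2 : ℝ) • (Literature.Analysis.FluidPDE.stdMatrix (fderiv ℝ (u t) x : EuclideanSpace ℝ (Fin 3) →ₗ[ℝ] EuclideanSpace ℝ (Fin 3)) + (Literature.Analysis.FluidPDE.stdMatrix (fderiv ℝ (u t) x : EuclideanSpace ℝ (Fin 3) →ₗ[ℝ] EuclideanSpace ℝ (Fin 3)))ᵀ))).det ≤ (2 * b / (-t)) * (∑ i, ∑ j, (((1 / 2 : ℝ) • (Literature.Analysis.FluidPDE.stdMatrix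 (fderiv ℝ (u t) x : EuclideanSpace ℝ (Fin 3) →ₗ[ℝ] EuclideanSpace ℝ (Fin 3)) + (Literature.Analysis.FluidPDE.stdMatrix (fderiv ℝ (u t) x : EuclideanSpace ℝ (Fin 3) →ₗ[ℝ] EuclideanSpace ℝ (Fin 3)))ᵀ)) i j) ^ 2)) := by
  refine ⟨0, 0, 0, by norm_num, squeezeClass_zero le_rfl, fun t ht x => ?_⟩
  have hfd : fderiv ℝ ((0 : ℝ → ℝ³ → ℝ³) t) x = 0 := by
    simp only [Pi.zero_apply]
    exact fderiv_const_apply 0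
  have hz : ((1 / 2 : ℝ) • (Literature.Analysis.FluidPDE.stdMatrix (fderiv ℝ ((0 : ℝ → ℝ³ → ℝ³) t) x : EuclideanSpace ℝ (Fin 3) →ₗ[ℝ] EuclideanSpace ℝ (Fin 3)) + (Literature.Analysis.FluidPDE.stdMatrix (fderiv ℝ ((0 : ℝ → ℝ³ → ℝ³) t) x : EuclideanSpace ℝ (Fin 3) →ₗ[ℝ] EuclideanSpace ℝ (Fin 3)))ᵀ)) = 0 := by
    ext i j
    simp
  rw [hz]
  simp

/-! ## What the open stub `stub_largeExcessExclusion` IS: `K` and the cubic margin are cosmetic -/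

/-- "No element of any `𝒦_C` attains a class-maximal Leray-gauge middle strain eigenvalue STRICTLY
above `1/4`" — the tree's `NoMarginalExtremal` (`… → m < 1/4`) minus the boundary value `m = 1/4`. -/
def NoAttainedClassMaxAboveQuarter : Prop :=
  ∀ (C m : ℝ) (u : ℝ → EuclideanSpace ℝ (Fin 3) → EuclideanSpace ℝ (Fin 3)) (t₀ : ℝ) (x₀ : EuclideanSpace ℝ (Fin 3)), t₀ < 0 → (ContDiffOn ℝ (⊤ : ℕ∞) (Function.uncurry u) (Set.Iio 0 ×ˢ Set.univ) ∧ (∀ t < 0, Literature.Analysis.FluidPDE.VectorCalculus.IsDivFree (u t)) ∧ (∀ s t : ℝ, s < t → t < 0 → ∀ x, u t x = Literature.Analysis.FluidPDE.heatFlow (u s) (t-s) x - ∫ τ in Set.Ioo s t, ∫ y, ((-(inner ℝ (x-y) (u τ y) / (2*(t-τ)) * Literature.Analysis.UnboundedOperators.heatKernel (t-τ) (x-y))) • u τ y + (∫ σ in Set.Ioi (t-τ), Literature.Analysis.UnboundedOperators.heatKernel σ (x-y) / (4*σ^2)) • (inner ℝ (x-y) (u τ y) • u τ y + inner ℝ (u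 τ y) (u τ y) • (x-y) + inner ℝ (x-y) (u τ y) • u τ y) - ((∫ σ in Set.Ioi (t-τ), Literature.Analysis.UnboundedOperators.heatKernel σ (x-y) / (8*σ^3)) * (inner ℝ (x-y) (u τ y) * inner ℝ (x-y) (u τ y))) • (x-y))) ∧ Literature.Analysis.FluidPDE.HasTypeITimeDecay C u ∧ (∀ (x₀ : EuclideanSpace ℝ (Fin 3)) (t₀ r : ℝ), t₀ ≤ 0 → 0 < r → (∀ t, t₀ - r^2 < t → t < t₀ → r⁻¹ * ∫ x in Metric.ball x₀ r, ‖u t x‖^2 ≤ C) ∧ r⁻¹ * ∫ t in Set.Ioo (t₀ - r^2) t₀, ∫ x in Metric.ball x₀ r, ‖fderiv ℝ (u t) x‖^2 ≤ C)) → m ≤ Literature.Analysis.FluidPDE.lerayMiddleStrain u t₀ x₀ → (∀ (v' : ℝ → EuclideanSpace ℝ (Fin 3) → EuclideanSpace ℝ (Fin 3)), ContDiffOn ℝ (⊤ : ℕ∞) (Function.uncurry v') (Set.Iio 0 ×ˢ Set.univ) ∧ (∀ t < 0, Literature.Analysis.FluidPDE.VectorCalculus.IsDivFree (v' t)) ∧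 (∀ s t : ℝ, s < t → t < 0 → ∀ x, v' t x = Literature.Analysis.FluidPDE.heatFlow (v' s) (t-s) x - ∫ τ in Set.Ioo s t, ∫ y, ((-(inner ℝ (x-y) (v' τ y) / (2*(t-τ)) * Literature.Analysis.UnboundedOperators.heatKernel (t-τ) (x-y))) • v' τ y + (∫ σ in Set.Ioi (t-τ), Literature.Analysis.UnboundedOperators.heatKernel σ (x-y) / (4*σ^2)) • (inner ℝ (x-y) (v' τ y) • v' τ y + inner ℝ (v' τ y) (v' τ y) • (x-y) + inner ℝ (x-y) (v' τ y) • v' τ y) - ((∫ σ in Set.Ioi (t-τ), Literature.Analysis.UnboundedOperators.heatKernel σ (x-y) / (8*σ^3)) * (inner ℝ (x-y) (v' τ y) * inner ℝ (x-y) (v' τ y))) • (x-y))) ∧ Literature.Analysis.FluidPDE.HasTypeITimeDecay C v' ∧ (∀ (x₀ : EuclideanSpace ℝ (Fin 3)) (t₀ r : ℝ), t₀ ≤ 0 → 0 < r → (∀ t, t₀ - r^2 < t → t < t₀ → r⁻¹ * ∫ x in Metric.ball x₀ r, ‖v' t x‖^2 ≤ C) ∧ r⁻¹ * ∫ t in Set.Ioo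 (t₀ - r^2) t₀, ∫ x in Metric.ball x₀ r, ‖fderiv ℝ (v' t) x‖^2 ≤ C) → ∀ t < 0, ∀ x, Literature.Analysis.FluidPDE.lerayMiddleStrain v' t x ≤ m) → m ≤ 1 / 4

/-- **`stub_largeExcessExclusion ⇔ NoAttainedClassMaxAboveQuarter`** (given the true stub
`stub_gaugeStrainBound`): the stub quantifies over EVERY `K` carrying the class-wide strain bound,
and that bound is monotone in `K`, so `K → ∞` removes the cubic margin `2m³/K²`; conversely
`1/4 ≤ m − 2m³/K²` with `m ≥ 0` forces `m > 1/4`. So the "large-excess regime" is exactly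
"attained class maximum `m > 1/4`": the crux at threshold `1/4` with the single boundary value
`m = 1/4` shaved off (that value is what the cubic refinement + leaky law at `b = 1/4 − 1/(32K²)`
absorb). -/
theorem largeExcess_iff_noAttainedClassMaxAboveQuarter (hG : S_stub_gaugeStrainBound) :
    S_stub_largeExcessExclusion ↔ NoAttainedClassMaxAboveQuarter := by
  constructor
  · intro h C m u t₀ x₀ ht₀ hu hatt hmax
    by_contra hgt
    rw [not_le] at hgt
    obtain ⟨K₀, hK₀, hKb⟩ := hG C
    have hm : 0 < m - 1 / 4 := by linarith
    set Q : ℝ := 2 * m ^ 3 / (m - 1 / 4) with hQ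
    have hQ0 : 0 ≤ Q := by positivity
    set K : ℝ := K₀ + Q + 1 with hKdef
    have hK1 : 1 ≤ K := by rw [hKdef]; linarith
    have hKpos : 0 < K := by linarith
    have hK0K : K₀ ≤ K := by rw [hKdef]; linarith
    have hQK : Q ≤ K ^ 2 := by nlinarith
    have hreg : 1 / 4 ≤ m - 2 * m ^ 3 / K ^ 2 := by
      have hK2 : 0 < K ^ 2 := by positivity
      have h1 : 2 * m ^ 3 / K ^ 2 ≤ 2 * m ^ 3 / Q := by
        rcases hQ0.eq_or_lt with hQz | hQpos
        · -- `Q = 0` forces `m = 0`, impossible; handle formally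
          exfalso
          have : 2 * m ^ 3 = 0 := by
            have := hQz.symm
            rw [hQ, div_eq_zero_iff] at this
            rcases this with h0 | h0
            · exact h0
            · linarith
          have hm0 : m = 0 := by
            have : m ^ 3 = 0 := by linarith
            exact pow_eq_zero_iff (n := 3) (by norm_num) |>.1 this
          linarith
        · exact div_le_div_of_nonneg_left (by positivity) hQpos hQK
      have h2 : 2 * m ^ 3 / Q = m - 1 / 4 := by
        rw [hQ]
        have h2m : (2 : ℝ) * m ^ 3 ≠ 0 := by positivity
        field_simp
      linarith
    refine h C K m u t₀ x₀ hKpos (fun v' hv' t ht x => ⟨?_, hmax v' hv' t ht x⟩) (by linarith)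
      hreg ht₀ hu hatt
    have ht' : 0 < -t := neg_pos.2 ht
    calc _ ≤ (K₀ / (-t)) ^ 2 := hKb v' hv' t ht x
      _ ≤ (K / (-t)) ^ 2 := by
          gcongr
  · intro h C K m u t₀ x₀ hK hcls hm0 hreg ht₀ hu hatt
    have hmle : m ≤ 1 / 4 := h C m u t₀ x₀ ht₀ hu hatt (fun v' hv' t ht x => (hcls v' hv' t ht x).2)
    have h3 : 0 ≤ 2 * m ^ 3 / K ^ 2 := by positivity
    have hz : 2 * m ^ 3 / K ^ 2 = 0 := by linarith
    rw [div_eq_zero_iff] at hz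
    rcases hz with hz | hz
    · have hm3 : m ^ 3 = 0 := by linarith
      have hm0' : m = 0 := pow_eq_zero_iff (n := 3) (by norm_num) |>.1 hm3
      rw [hm0'] at hreg
      norm_num at hreg
    · exact absurd hz (by positivity)

/-! ## The currency dictionary between this line's leaky law and the sibling's `MustSqueeze` family -/

/-- **Production ceiling ⇒ middle-eigenvalue ceiling with factor 3/2** (matrix form): for a
trace-free `A`, `0 ≤ b` and `−4 det S ≤ 2b |S|²_F` (`S = ½(A + Aᵀ)`) one has `μ₁(A + Aᵀ) ≤ 3b`,
i.e. `λ₂(S) ≤ 3b/2`. From `production_identity` (`−4 det S = μ₁σ − ½μ₁³`) and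
`six_mul_midStrain_sq_le` (`(3/2)μ₁² ≤ σ`): for `μ₁ > 0`, `−4 det S ≥ (2/3) μ₁ σ`. -/
theorem eigenvalues₀_mid_le_of_production_ceiling (A : Matrix (Fin 3) (Fin 3) ℝ) (hA : A.trace = 0)
    {b : ℝ} (hb : 0 ≤ b)
    (h : -4 * (((1 / 2 : ℝ) • (A + Aᵀ))).det ≤ 2 * b * (∑ i, ∑ j, (((1 / 2 : ℝ) • (A + Aᵀ)) i j) ^ 2)) :
    (Matrix.isHermitian_add_transpose_self A).eigenvalues₀ 1 ≤ 3 * b := by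
  rw [production_identity A hA] at h
  have h6 := six_mul_midStrain_sq_le A hA
  set μ := (Matrix.isHermitian_add_transpose_self A).eigenvalues₀ 1
  set σ := ∑ i, ∑ j, (((1 / 2 : ℝ) • (A + Aᵀ)) i j) ^ 2
  by_contra hlt
  rw [not_le] at hlt
  have hμ : 0 < μ := by linarith
  have hσ : 0 < σ := by nlinarith
  nlinarith [mul_le_mul_of_nonneg_left h6 (by positivity : (0 : ℝ) ≤ μ / 3),
    mul_pos hσ (sub_pos.2 hlt)]

/-- **Pointwise dictionary on a field**: at `t < 0`, for a divergence-free slice, the production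
ceiling `−4 det S(t,x) ≤ (2b/(−t)) |S(t,x)|²_F` with `b ≥ 0` gives `Λ_u(t,x) ≤ 3b/2`. -/
theorem lerayMiddleStrain_le_of_ceiling {u : ℝ → ℝ³ → ℝ³} {t : ℝ} (ht : t < 0)
    (hdiv : VectorCalculus.IsDivFree (u t)) {b : ℝ} (hb : 0 ≤ b) (x : ℝ³)
    (hceil : -4 * (((1 / 2 : ℝ) • (Literature.Analysis.FluidPDE.stdMatrix (fderiv ℝ (u t) x : EuclideanSpace ℝ (Fin 3) →ₗ[ℝ] EuclideanSpace ℝ (Fin 3)) + (Literature.Analysis.FluidPDE.stdMatrix (fderiv ℝ (u t) x : EuclideanSpace ℝ (Fin 3) →ₗ[ℝ] EuclideanSpace ℝ (Fin 3)))ᵀ))).det ≤ (2 * b / (-t)) * (∑ i, ∑ j, (((1 / 2 : ℝ) • (Literature.Analysis.FluidPDE.stdMatrix (fderiv ℝ (u t) x : EuclideanSpace ℝ (Fin 3) →ₗ[ℝ] EuclideanSpace ℝ (Fin 3)) + (Literature.Analysis.FluidPDE.stdMatrix (fderiv ℝ (u t) x : EuclideanSpace ℝ (Fin 3) →ₗ[ℝ]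 EuclideanSpace ℝ (Fin 3)))ᵀ)) i j) ^ 2)) :
    lerayMiddleStrain u t x ≤ 3 * b / 2 := by
  have ht' : 0 < -t := neg_pos.2 ht
  set M := Literature.Analysis.FluidPDE.stdMatrix (fderiv ℝ (u t) x : ℝ³ →ₗ[ℝ] ℝ³) with hM
  have htr : M.trace = 0 := by rw [hM, trace_stdMatrix]; exact hdiv x
  have hb' : 0 ≤ b / (-t) := div_nonneg hb ht'.le
  have hceil' : -4 * (((1 / 2 : ℝ) • (M + Mᵀ))).det ≤ 2 * (b / (-t)) * (∑ i, ∑ j, (((1 / 2 : ℝ) • (M + Mᵀ)) i j) ^ 2) := by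
    rw [mul_div_assoc'] ; exact hceil
  have hμ := eigenvalues₀_mid_le_of_production_ceiling M htr hb' hceil'
  rw [lerayMiddleStrain_eq_eigenvalues₀]
  calc (-t) * (2⁻¹ * (Matrix.isHermitian_add_transpose_self M).eigenvalues₀ 1)
      ≤ (-t) * (2⁻¹ * (3 * (b / (-t)))) := by gcongr
    _ = 3 * b / 2 := by
        have ht0 : t ≠ 0 := ht.ne
        field_simp

/-- `LeakyBelow B`: the leaky quarter law for every production threshold `b < B` (so
`stub_leakyQuarterLawCeiling = LeakyBelow (1/4)`, `leaky_eq`). -/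
def LeakyBelow (B : ℝ) : Prop :=
  ∀ (C b : ℝ), b < B → ∀ (u : ℝ → EuclideanSpace ℝ (Fin 3) → EuclideanSpace ℝ (Fin 3)), ContDiffOn ℝ (⊤ : ℕ∞) (Function.uncurry u) (Set.Iio 0 ×ˢ Set.univ) ∧ (∀ t < 0, Literature.Analysis.FluidPDE.VectorCalculus.IsDivFree (u t)) ∧ (∀ s t : ℝ, s < t → t < 0 → ∀ x, u t x = Literature.Analysis.FluidPDE.heatFlow (u s) (t-s) x - ∫ τ in Set.Ioo s t, ∫ y, ((-(inner ℝ (x-y) (u τ y) / (2*(t-τ)) * Literature.Analysis.UnboundedOperators.heatKernel (t-τ) (x-y))) • u τ y + (∫ σ in Set.Ioi (t-τ), Literature.Analysis.UnboundedOperators.heatKernel σ (x-y) / (4*σ^2)) • (inner ℝ (x-y) (u τ y) • u τ y + inner ℝ (u τ y) (u τ y) • (x-y) + inner ℝ (x-y) (u τ y) • u τ y) - ((∫ σ in Set.Ioi (t-τ), Literature.Analysis.UnboundedOperators.heatKernel σ (x-y) / (8*σ^3)) * (inner ℝ (x-y) (u τ y) * inner ℝ (x-y) (u τ y))) • (x-y)))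 ∧ Literature.Analysis.FluidPDE.HasTypeITimeDecay C u ∧ (∀ (x₀ : EuclideanSpace ℝ (Fin 3)) (t₀ r : ℝ), t₀ ≤ 0 → 0 < r → (∀ t, t₀ - r^2 < t → t < t₀ → r⁻¹ * ∫ x in Metric.ball x₀ r, ‖u t x‖^2 ≤ C) ∧ r⁻¹ * ∫ t in Set.Ioo (t₀ - r^2) t₀, ∫ x in Metric.ball x₀ r, ‖fderiv ℝ (u t) x‖^2 ≤ C) → (∀ t < 0, ∀ x, -4 * (((1 / 2 : ℝ) • (Literature.Analysis.FluidPDE.stdMatrix (fderiv ℝ (u t) x : EuclideanSpace ℝ (Fin 3) →ₗ[ℝ] EuclideanSpace ℝ (Fin 3)) + (Literature.Analysis.FluidPDE.stdMatrix (fderiv ℝ (u t) x : EuclideanSpace ℝ (Fin 3) →ₗ[ℝ] EuclideanSpace ℝ (Fin 3)))ᵀ))).det ≤ (2 * b / (-t)) * (∑ i, ∑ j, (((1 / 2 : ℝ) • (Literature.Analysis.FluidPDE.stdMatrix (fderiv ℝ (u t) x : EuclideanSpace ℝ (Fin 3) →ₗ[ℝ] EuclideanSpace ℝ (Fin 3))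 + (Literature.Analysis.FluidPDE.stdMatrix (fderiv ℝ (u t) x : EuclideanSpace ℝ (Fin 3) →ₗ[ℝ] EuclideanSpace ℝ (Fin 3)))ᵀ)) i j) ^ 2)) → ∀ t < 0, ∀ x, u t x = 0

/-- Definitional. -/
theorem leaky_eq : S_stub_leakyQuarterLawCeiling = LeakyBelow (1 / 4) := rfl

/-- `MustSqueezeFamily`: the sibling crux's family "`MustSqueezeAt a` for every `a < 1/4`", VERBATIM
the hypothesis `hMS` of the tree's `extremalBiaxialitySubcritical_bootstrap` (Λ-currency). -/
def MustSqueezeFamily : Prop :=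
  ∀ a : ℝ, a < 1 / 4 → ∀ (C : ℝ) (u : ℝ → EuclideanSpace ℝ (Fin 3) → EuclideanSpace ℝ (Fin 3)), ContDiffOn ℝ (⊤ : ℕ∞) (Function.uncurry u) (Set.Iio 0 ×ˢ Set.univ) ∧ (∀ t < 0, Literature.Analysis.FluidPDE.VectorCalculus.IsDivFree (u t)) ∧ (∀ s t : ℝ, s < t → t < 0 → ∀ x, u t x = Literature.Analysis.FluidPDE.heatFlow (u s) (t-s) x - ∫ τ in Set.Ioo s t, ∫ y, ((-(inner ℝ (x-y) (u τ y) / (2*(t-τ)) * Literature.Analysis.UnboundedOperators.heatKernel (t-τ) (x-y))) • u τ y + (∫ σ in Set.Ioi (t-τ), Literature.Analysis.UnboundedOperators.heatKernel σ (x-y) / (4*σ^2)) • (inner ℝ (x-y) (u τ y) • u τ y + inner ℝ (u τ y) (u τ y) • (x-y) + inner ℝ (x-y) (u τ y) • u τ y) - ((∫ σ in Set.Ioi (t-τ), Literature.Analysis.UnboundedOperators.heatKernel σ (x-y) / (8*σ^3)) * (inner ℝ (x-y) (u τ y) * inner ℝ (x-y) (u τ y))) • (x-y))) ∧ Literature.Analysis.FluidPDE.HasTypeITimeDecay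 C u ∧ (∀ (x₀ : EuclideanSpace ℝ (Fin 3)) (t₀ r : ℝ), t₀ ≤ 0 → 0 < r → (∀ t, t₀ - r^2 < t → t < t₀ → r⁻¹ * ∫ x in Metric.ball x₀ r, ‖u t x‖^2 ≤ C) ∧ r⁻¹ * ∫ t in Set.Ioo (t₀ - r^2) t₀, ∫ x in Metric.ball x₀ r, ‖fderiv ℝ (u t) x‖^2 ≤ C) → (∀ t < 0, ∀ x, (∃ v w : EuclideanSpace ℝ (Fin 3), ‖v‖ = 1 ∧ ‖w‖ = 1 ∧ inner ℝ v w = 0 ∧ ∀ α β : ℝ, (-t) * inner ℝ (fderiv ℝ (u t) x (α • v + β • w)) (α • v + β • w) ≤ a * (α^2 + β^2))) → ∀ t < 0, ∀ x, u t x = 0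

/-- **What the sibling's Λ-currency family delivers BY NAME: the leaky law only below `1/6`.**
A production ceiling `b` gives `Λ ≤ 3·max(b,0)/2` pointwise (`lerayMiddleStrain_le_of_ceiling`),
which is a `MustSqueezeAt a` hypothesis with `a < 1/4` iff `b < 1/6`. -/
theorem leakyBelow_sixth_of_mustSqueezeFamily (hMS : MustSqueezeFamily) : LeakyBelow (1 / 6) := by
  intro C b hb u hu hceil t ht x
  set a : ℝ := 3 * max b 0 / 2 with ha
  have ha4 : a < 1 / 4 := by
    rw [ha]
    have : max b 0 < 1 / 6 := max_lt hb (by norm_num)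
    linarith
  refine hMS a ha4 C u hu (fun s hs y => (lerayMiddleStrain_le_iff hs a).1 ?_) t ht x
  have hs' : 0 < -s := neg_pos.2 hs
  have hb0 : 0 ≤ max b 0 := le_max_right _ _
  -- the ceiling at `b` implies the ceiling at `max b 0`
  have hc := hceil s hs y
  have hσ : 0 ≤ (∑ i, ∑ j, (((1 / 2 : ℝ) • (Literature.Analysis.FluidPDE.stdMatrix (fderiv ℝ (u s) y : EuclideanSpace ℝ (Fin 3) →ₗ[ℝ] EuclideanSpace ℝ (Fin 3)) + (Literature.Analysis.FluidPDE.stdMatrix (fderiv ℝ (u s) y : EuclideanSpace ℝ (Fin 3) →ₗ[ℝ] EuclideanSpace ℝ (Fin 3)))ᵀ)) i j) ^ 2) := by positivity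
  have hmono : (2 * b / (-s)) * (∑ i, ∑ j, (((1 / 2 : ℝ) • (Literature.Analysis.FluidPDE.stdMatrix (fderiv ℝ (u s) y : EuclideanSpace ℝ (Fin 3) →ₗ[ℝ] EuclideanSpace ℝ (Fin 3)) + (Literature.Analysis.FluidPDE.stdMatrix (fderiv ℝ (u s) y : EuclideanSpace ℝ (Fin 3) →ₗ[ℝ] EuclideanSpace ℝ (Fin 3)))ᵀ)) i j) ^ 2) ≤ (2 * max b 0 / (-s)) * (∑ i, ∑ j, (((1 / 2 : ℝ) • (Literature.Analysis.FluidPDE.stdMatrix (fderiv ℝ (u s) y : EuclideanSpace ℝ (Fin 3) →ₗ[ℝ] EuclideanSpace ℝ (Fin 3)) + (Literature.Analysis.FluidPDE.stdMatrix (fderiv ℝ (u s) y : EuclideanSpace ℝ (Fin 3) →ₗ[ℝ] EuclideanSpace ℝ (Fin 3)))ᵀ)) i j) ^ 2) := by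
    apply mul_le_mul_of_nonneg_right _ hσ
    apply div_le_div_of_nonneg_right _ hs'.le
    linarith [le_max_left b 0]
  have := lerayMiddleStrain_le_of_ceiling hs (hu.2.1 s hs) hb0 y (hc.trans hmono)
  rw [ha]; linarith

/-- **Sharpness of the dictionary (the factor `3/2` is attained, by an exact Navier–Stokes flow):**
for `b ≥ 0`, Leray's self-similar biaxial strain `selfSimilarStrain (3b/2)` (an exact classical NS
flow on `ℝ³ × (−∞,0)`, `Negative.isClassicalNSSolutionOn_selfSimilarStrain`, outside `𝒦_C` only by
its far field) meets the production ceiling `b` with EQUALITY at every point and has `Λ ≡ 3b/2`.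
So for `b ∈ [1/6, 1/4)` no pointwise argument turns the hypothesis of `stub_leakyQuarterLawCeiling`
into a `MustSqueezeAt a` hypothesis with `a < 1/4`: the stub needs the sibling's signed enstrophy
budget re-run in PRODUCTION currency (its proof uses only `∫φ ω·Sω = 4∫φ det∇u − 4∫φ det S`). -/
theorem dictionary_sharp {b : ℝ} (_hb : 0 ≤ b) {t : ℝ} (ht : t < 0) (x : ℝ³) :
    (-4 * (((1 / 2 : ℝ) • (Literature.Analysis.FluidPDE.stdMatrix (fderiv ℝ (selfSimilarStrain (3 * b / 2) t) x : EuclideanSpace ℝ (Fin 3) →ₗ[ℝ] EuclideanSpace ℝ (Fin 3)) + (Literature.Analysis.FluidPDE.stdMatrix (fderiv ℝ (selfSimilarStrain (3 * b / 2) t) x : EuclideanSpace ℝ (Fin 3) →ₗ[ℝ] EuclideanSpace ℝ (Fin 3)))ᵀ))).det = (2 * b / (-t)) * (∑ i, ∑ j, (((1 / 2 : ℝ) • (Literature.Analysis.FluidPDE.stdMatrix (fderiv ℝ (selfSimilarStrain (3 * b / 2) t) x : EuclideanSpace ℝ (Fin 3) →ₗ[ℝ] EuclideanSpace ℝ (Fin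 3)) + (Literature.Analysis.FluidPDE.stdMatrix (fderiv ℝ (selfSimilarStrain (3 * b / 2) t) x : EuclideanSpace ℝ (Fin 3) →ₗ[ℝ] EuclideanSpace ℝ (Fin 3)))ᵀ)) i j) ^ 2)) ∧
      3 * b / 2 ≤ lerayMiddleStrain (selfSimilarStrain (3 * b / 2)) t x := by
  refine ⟨?_, (le_lerayMiddleStrain_iff ht _).2 (selfSimilarStrain_lamGE _ ht x)⟩
  have ht' : (-t) ≠ 0 := (neg_pos.2 ht).ne'
  set c : ℝ := 3 * b / 2 * (-t)⁻¹ with hc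
  have hM : Literature.Analysis.FluidPDE.stdMatrix (fderiv ℝ (selfSimilarStrain (3 * b / 2) t) x : ℝ³ →ₗ[ℝ] ℝ³) = Matrix.diagonal ![c, c, -(2 * c)] := by
    have hfd : fderiv ℝ (selfSimilarStrain (3 * b / 2) t) x = linearStrainL c c (-(2 * c)) := by
      rw [hc]; exact fderiv_ampStrain _ t x
    ext i j
    rw [stdMatrix_apply, hfd]
    fin_cases i <;> fin_cases j <;> simp [linearStrain, Matrix.diagonal]
  rw [hM]
  have hT : (Matrix.diagonal ![c, c, -(2 * c)])ᵀ = Matrix.diagonal ![c, c, -(2 * c)] := Matrix.diagonal_transpose _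
  rw [hT, ← two_smul ℝ (Matrix.diagonal ![c, c, -(2 * c)]), smul_smul]
  norm_num
  have e1 : ∏ i, (![c, c, -(2 * c)] : Fin 3 → ℝ) i = -(2 * c ^ 3) := by
    simp [Fin.prod_univ_three]; ring
  have e2 : ∑ i, ∑ j, Matrix.diagonal (![c, c, -(2 * c)] : Fin 3 → ℝ) i j ^ 2 = 6 * c ^ 2 := by
    simp [Fin.sum_univ_three, Matrix.diagonal]; ring
  rw [e1, e2, hc]
  field_simp
  ring

end Summit.NavierStokesRegularity.NavierStokesRegularity.Cruxes.ExtremalBiaxialitySubcritical.DrefuteQBP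

end
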